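import Summits.HodgeConjecture.CorCM.GaloisCyclicSemidirectEightNormPairs
import HarnessLib

/-!
# `μ₄`-norm-pair certificates: `C_p ⋊ C₈` is BAD for `p = 41, 73, 89`

COR-CM (cell `pub-hodgecm2`), binder seat b04 (gen 29), count-neutral claim CYCLIC-SEMIDIRECT-EIGHT-DEGENERATE — instances
of part V (`GaloisCyclicSemidirectEight.exists_simple_degenerate_of_normPair`): a Galois CM field `K` with `Gal(K/ℚ) ≅ C_p ⋊
C₈` (`φ(1)` = inversion) carries a simple DEGENERATE CM abelian `4p`-fold with a rational `(q,q)` class outside the divisor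
ring on some power as soon as `ℤ/p` has a `μ₄`-norm pair `(k₀, k₁)` (sheets `kⱼ : ℤ/p → ℤ/4` whose two balance identities
make the coefficient of `ζ^d` in `G₀(ζ)G₀(ζ⁻¹) − i·G₁(ζ)G₁(ζ⁻¹)`, `Gⱼ(ζ) = Σ_v i^{kⱼ(v)} ζ^v`, independent of `d`); the
certificate is two vectors in `(ℤ/4)^p`, checked by `decide` on `ℤ/p` alone.  Pairs `p = 41, 73, 89` (all `p ≡ 9 (mod 16)`;
the first BAD primes `p ≡ 1 (mod 8)` after `17`) from the seat's orbit-compressed meet-in-the-middle search (gen 29): both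
sheets constant on the eight cosets of the octic residues `(ℤ/p)ˣ⁸` (index `8`, ODD order `(p−1)/8` — a multiplier group `H
∋ −1` can never carry a pair, since then `G(ζ⁻¹) = G(ζ)` and `i` is not a square in `ℚ(ζ_{4p})`); `192 / 128 / 1024` such
pairs exist for `p = 41 / 73 / 89` and none for `p = 137, 233, 281, 313`.  KERNEL ONLY: theorems; no definition, no named
fact, no `sorry`.  `HC_CM` is neither used nor claimed.

## References

* [Kubota1965] T. Kubota, *On the field extension by complex multiplication*, Trans. AMS 118 (1965), §2, §4 Lemma 2.
* [Shimura1998] G. Shimura, *Abelian Varieties with Complex Multiplication and Modular Functions*, §6.2 Thm. 3, §8.2 Prop. 26.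
* [Gordon1999HodgeAVSurvey] B. B. Gordon, *A survey of the Hodge conjecture for abelian varieties*, Thm. 6.4, §9.3.
-/

noncomputable section

open CategoryTheory CategoryTheory.Limits NumberField
open scoped BigOperators

namespace Summit.HodgeConjecture.CorCM.GaloisCyclicSemidirectEight

open Literature.NumberTheory.ComplexMultiplication
open Literature.AlgebraicGeometry.Motives (AbelianVariety CMType)
open Literature.AlgebraicGeometry.HodgeTheory
open Literature.AlgebraicGeometry.ComplexMultiplication (IsCMTypeRealisation)
open Literature.AlgebraicGeometry.Pohlmann1968
open Literature.Barriers.HodgeConjecture (divisorClassesSpan)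

variable {K : Type} [Field K] [NumberField K] [IsCMField K] [IsGalois ℚ K]

/-- **`Gal(K/ℚ) ≅ C_41 ⋊ C₈` is BAD**: the `μ₄`-norm pair `k₀ = [0, 0, 1, 0, 3, 1, 1, 0, 1, 1, 0, 2, 2, 0, 1, 1, 0, 1, 0, 1, 1,
1, 1, 3, 1, 3, 1, 1, 2, 0, 0, 3, 1, 1, 2, 1, 1, 0, 2, 1, 3]`, `k₁ = [0, 3, 0, 3, 3, 1, 0, 3, 1, 1, 3, 3, 3, 3, 0, 2, 3, 0,
3, 0, 0, 1, 2, 3, 2, 3, 0, 2, 3, 3, 3, 3, 0, 0, 3, 2, 0, 3, 3, 1, 3]` in `ℤ/41` (both sheets constant on the cosets of the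
subgroup of order `5` of `(ℤ/41)ˣ`) (in the proof `kⱼ(v)` is the `v`-th base-`4` digit of the numeral `Nⱼ = Σ_v kⱼ(v)·4^v`)
gives a simple DEGENERATE abelian `164`-fold with CM by `K` and a rational `(q,q)` class outside the divisor ring on some
power. [cite: Kubota1965, §4 Lemma 2] [cite: Shimura1998, §6.2 Thm. 3 and §8.2 Prop. 26] [cite: Gordon1999HodgeAVSurvey,
Thm. 6.4 and §9.3] -/
theorem exists_simple_degenerate_cyclic41_semidirect8_normPair
    (φ : Multiplicative (ZMod 8) →* MulAut (Multiplicative (ZMod 41)))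
    (hφ : ∀ v : Multiplicative (ZMod 41), φ (Multiplicative.ofAdd 1) v = v⁻¹)
    (e : (K ≃ₐ[ℚ] K) ≃* Multiplicative (ZMod 41) ⋊[φ] Multiplicative (ZMod 8)) :
    ∃ (Φ : CMType K) (φ₀ : K →+* ℂ) (A : AbelianVariety ℂ) (ι : 𝓞 K →+* End A)
      (θ : K →+* Module.End ℂ (complexBetti A.X 1)),
      IsPrimitive (ℂ ≃+* ℂ) Φ.1 φ₀ ∧ ¬ IsNondegenerate Φ ∧ IsCMTypeRealisation Φ A ι θ ∧ A.IsSimple ∧ A.dim = 164 ∧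
      ∃ n q : ℕ, ∃ x : complexBetti (⨁ fun _ : Fin n => A).X (2 * q), IsRationalClass x ∧
        IsOfHodgeType (⨁ fun _ : Fin n => A).dim (⨁ fun _ : Fin n => A).X (2 * q) q q x ∧
        x ∉ divisorClassesSpan (⨁ fun _ : Fin n => A).X (⨁ fun _ : Fin n => A).dim q := by
  -- the sheets are read off the base-`4` digits of two numerals (`kⱼ(v)` = digit `v` of `Nⱼ`): `decide +kernel` then costs
  -- `O(1)` GMP operations per evaluation instead of a length-`41` `![…]` lookup
  obtain ⟨Φ, φ₀, A, ι, θ, h1, h2, h3, h4, h5, h6⟩ := @exists_simple_degenerate_of_normPair 41 ⟨by norm_num⟩ K _ _ _ _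
    (by norm_num) φ hφ e
    (fun v : ZMod 41 => (((4086724134418593385617168 : ℕ) / 4 ^ v.val % 4 : ℕ) : ZMod 4))
    (fun v : ZMod 41 => (((4215615944583532885952460 : ℕ) / 4 ^ v.val % 4 : ℕ) : ZMod 4))
    ⟨2, by decide +kernel⟩ (by decide +kernel) (by decide +kernel)
  exact ⟨Φ, φ₀, A, ι, θ, h1, h2, h3, h4, by norm_num at h5; exact h5, h6⟩

/-- **`Gal(K/ℚ) ≅ C_73 ⋊ C₈` is BAD**: the `μ₄`-norm pair `k₀ = [0, 0, 0, 1, 0, 0, 1, 0, 0, 1, 0, 1, 1, 1, 0, 1, 0, 0, 1, 1, 0,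
1, 1, 1, 1, 1, 1, 1, 0, 1, 1, 1, 0, 0, 0, 1, 1, 0, 1, 0, 0, 1, 1, 1, 1, 0, 1, 1, 1, 1, 1, 1, 1, 0, 1, 0, 0, 1, 1, 0, 1, 1,
1, 0, 0, 1, 0, 1, 0, 1, 1, 1, 1]`, `k₁ = [1, 3, 3, 1, 3, 3, 1, 3, 3, 3, 3, 3, 1, 3, 3, 3, 3, 3, 3, 1, 3, 3, 3, 1, 1, 3, 3,
3, 3, 3, 3, 3, 3, 3, 3, 3, 3, 3, 1, 3, 3, 3, 3, 3, 3, 3, 1, 3, 1, 3, 3, 3, 3, 3, 3, 3, 3, 3, 3, 3, 3, 3, 3, 3, 3, 3, 3, 3,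
3, 3, 3, 3, 3]` in `ℤ/73` (both sheets constant on the cosets of the subgroup of order `9` of `(ℤ/73)ˣ`) (in the proof
`kⱼ(v)` is the `v`-th base-`4` digit of the numeral `Nⱼ = Σ_v kⱼ(v)·4^v`) gives a simple DEGENERATE abelian `292`-fold with
CM by `K` and a rational `(q,q)` class outside the divisor ring on some power. [cite: Kubota1965, §4 Lemma 2] [cite:
Shimura1998, §6.2 Thm. 3 and §8.2 Prop. 26] [cite: Gordon1999HodgeAVSurvey, Thm. 6.4 and §9.3] -/
theorem exists_simple_degenerate_cyclic73_semidirect8_normPair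
    (φ : Multiplicative (ZMod 8) →* MulAut (Multiplicative (ZMod 73)))
    (hφ : ∀ v : Multiplicative (ZMod 73), φ (Multiplicative.ofAdd 1) v = v⁻¹)
    (e : (K ≃ₐ[ℚ] K) ≃* Multiplicative (ZMod 73) ⋊[φ] Multiplicative (ZMod 8)) :
    ∃ (Φ : CMType K) (φ₀ : K →+* ℂ) (A : AbelianVariety ℂ) (ι : 𝓞 K →+* End A)
      (θ : K →+* Module.End ℂ (complexBetti A.X 1)),
      IsPrimitive (ℂ ≃+* ℂ) Φ.1 φ₀ ∧ ¬ IsNondegenerate Φ ∧ IsCMTypeRealisation Φ A ι θ ∧ A.IsSimple ∧ A.dim = 292 ∧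
      ∃ n q : ℕ, ∃ x : complexBetti (⨁ fun _ : Fin n => A).X (2 * q), IsRationalClass x ∧
        IsOfHodgeType (⨁ fun _ : Fin n => A).dim (⨁ fun _ : Fin n => A).X (2 * q) q q x ∧
        x ∉ divisorClassesSpan (⨁ fun _ : Fin n => A).X (⨁ fun _ : Fin n => A).dim q := by
  -- the sheets are read off the base-`4` digits of two numerals (`kⱼ(v)` = digit `v` of `Nⱼ`): `decide +kernel` then costs
  -- `O(1)` GMP operations per evaluation instead of a length-`73` `![…]` lookup
  obtain ⟨Φ, φ₀, A, ι, θ, h1, h2, h3, h4, h5, h6⟩ := @exists_simple_degenerate_of_normPair 73 ⟨by norm_num⟩ K _ _ _ _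
    (by norm_num) φ hφ e
    (fun v : ZMod 73 => (((29641344435734516856290340995892107047866432 : ℕ) / 4 ^ v.val % 4 : ℕ) : ZMod 4))
    (fun v : ZMod 73 => (((89202980794122324206146414550719993865035645 : ℕ) / 4 ^ v.val % 4 : ℕ) : ZMod 4))
    ⟨3, by decide +kernel⟩ (by decide +kernel) (by decide +kernel)
  exact ⟨Φ, φ₀, A, ι, θ, h1, h2, h3, h4, by norm_num at h5; exact h5, h6⟩

/-- **`Gal(K/ℚ) ≅ C_89 ⋊ C₈` is BAD**: the `μ₄`-norm pair `k₀ = [0, 0, 0, 0, 0, 0, 0, 0, 0, 0, 0, 1, 0, 1, 0, 1, 0, 0, 0, 0, 0,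
0, 1, 0, 0, 1, 1, 0, 0, 0, 1, 1, 0, 1, 0, 1, 0, 0, 0, 0, 0, 1, 0, 1, 1, 0, 0, 0, 0, 0, 1, 1, 1, 0, 0, 0, 0, 1, 0, 0, 1, 1,
1, 0, 0, 1, 1, 0, 0, 0, 1, 0, 0, 1, 0, 1, 0, 1, 0, 0, 0, 1, 1, 1, 0, 1, 1, 1, 1]`, `k₁ = [1, 3, 3, 3, 3, 3, 3, 3, 3, 3, 3,
3, 3, 1, 3, 1, 3, 3, 3, 3, 3, 3, 3, 3, 3, 3, 1, 3, 3, 3, 1, 1, 3, 3, 3, 1, 3, 3, 3, 3, 3, 3, 3, 3, 3, 3, 3, 3, 3, 3, 3, 1,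
1, 3, 3, 3, 3, 3, 3, 3, 1, 3, 1, 3, 3, 3, 3, 3, 3, 3, 1, 3, 3, 3, 3, 3, 3, 3, 3, 3, 3, 3, 3, 3, 3, 3, 3, 3, 3]` in `ℤ/89`
(both sheets constant on the cosets of the subgroup of order `11` of `(ℤ/89)ˣ`) (in the proof `kⱼ(v)` is the `v`-th base-`4`
digit of the numeral `Nⱼ = Σ_v kⱼ(v)·4^v`) gives a simple DEGENERATE abelian `356`-fold with CM by `K` and a rational
`(q,q)` class outside the divisor ring on some power. [cite: Kubota1965, §4 Lemma 2] [cite: Shimura1998, §6.2 Thm. 3 and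
§8.2 Prop. 26] [cite: Gordon1999HodgeAVSurvey, Thm. 6.4 and §9.3] -/
theorem exists_simple_degenerate_cyclic89_semidirect8_normPair
    (φ : Multiplicative (ZMod 8) →* MulAut (Multiplicative (ZMod 89)))
    (hφ : ∀ v : Multiplicative (ZMod 89), φ (Multiplicative.ofAdd 1) v = v⁻¹)
    (e : (K ≃ₐ[ℚ] K) ≃* Multiplicative (ZMod 89) ⋊[φ] Multiplicative (ZMod 8)) :
    ∃ (Φ : CMType K) (φ₀ : K →+* ℂ) (A : AbelianVariety ℂ) (ι : 𝓞 K →+* End A)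
      (θ : K →+* Module.End ℂ (complexBetti A.X 1)),
      IsPrimitive (ℂ ≃+* ℂ) Φ.1 φ₀ ∧ ¬ IsNondegenerate Φ ∧ IsCMTypeRealisation Φ A ι θ ∧ A.IsSimple ∧ A.dim = 356 ∧
      ∃ n q : ℕ, ∃ x : complexBetti (⨁ fun _ : Fin n => A).X (2 * q), IsRationalClass x ∧
        IsOfHodgeType (⨁ fun _ : Fin n => A).dim (⨁ fun _ : Fin n => A).X (2 * q) q q x ∧
        x ∉ divisorClassesSpan (⨁ fun _ : Fin n => A).X (⨁ fun _ : Fin n => A).dim q := by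
  -- the sheets are read off the base-`4` digits of two numerals (`kⱼ(v)` = digit `v` of `Nⱼ`): `decide +kernel` then costs
  -- `O(1)` GMP operations per evaluation instead of a length-`89` `![…]` lookup
  obtain ⟨Φ, φ₀, A, ι, θ, h1, h2, h3, h4, h5, h6⟩ := @exists_simple_degenerate_of_normPair 89 ⟨by norm_num⟩ K _ _ _ _
    (by norm_num) φ hφ e
    (fun v : ZMod 89 => (((127331893004631972797848610609863705436196552088485888 : ℕ) / 4 ^ v.val % 4 : ℕ) : ZMod 4))
    (fun v : ZMod 89 => (((383123885213684576245967866183734150493640135270203389 : ℕ) / 4 ^ v.val % 4 : ℕ) : ZMod 4))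
    ⟨11, by decide +kernel⟩ (by decide +kernel) (by decide +kernel)
  exact ⟨Φ, φ₀, A, ι, θ, h1, h2, h3, h4, by norm_num at h5; exact h5, h6⟩

end Summit.HodgeConjecture.CorCM.GaloisCyclicSemidirectEight

end
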